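import Summits.NavierStokesRegularity.FunctionalMining.TopEigStrainHeatLine
import HarnessLib

/-!
# The spectral mixture `F_ε = Φ_q + ε Z_q` is HEAT-COERCIVE at the explicit rate `εq/((1+ε)·C_NP(q))`
# (real `q > 2`, `ε ≥ 0`), and the normalised mixture `αΦ_q + βZ_q` (`α + β = 1`, `α, β > 0`) obeys the
# saturating law `(σ, γ) = (2q−3, (3q−3)/(2q−3))`

NS FUNCTIONAL MINING — search for candidate a priori estimates; no regularity claim.

This is the HEAT-SIDE INGREDIENT FILE of census-2's second hand on K1-Q6 escape (a) (cell `pub-nsfunc`,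
lead call INBOX l.4391 (iii)): the node `TopEigStrainMixLaw q ε` (`ε > 0`, `q > 2`) itself is the TREE
theorem `TopEig.topEigStrainMixLaw_of_two_lt` (`TopEigStrainMixLawHolds`, production route) and is NOT
restated here; it also follows from `TopEig.mix_saturatingLawSup` below by the scaling
`F_ε = (1+ε)·(αΦ_q + βZ_q)`, `α = (1+ε)⁻¹`, `β = ε(1+ε)⁻¹` (census-2's staged by-value hand
`TopEigStrainMixLawPos.lean`, kernel-checked, `rfl`-identical conclusion). What this file adds to the tree:

* §2 the ADMISSIBLE MIXTURE DENSITY `mixDensity q a b A = ((a·λ⁺(A))^q + (b‖A‖)^q)^{1/q}` (`a^q + b^q = 1`):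
  convex, `1`-Lipschitz (two-term Minkowski), `‖S‖/6 ≤ G(S) ≤ ‖S‖`, and `αΦ_q + βZ_q = ∫ G(S)^q`;
* §3–§4 HEAT COERCIVITY: `TopEig.mix_heatCoercive : HeatCoercive (αΦ_q + βZ_q) (βq/npConst q)` for
  `q > 2`, `α, β ≥ 0`, `α + β = 1`, with `npConst q = 6(1+(3^{q/2})²)(q/2)²·27` — along the heat line
  `v + tΔv` both moments are convex, `heatDissipation` is minus the right derivative
  (`heatDissipation_eq_neg_rightDeriv`), the `λ₁` part dissipates (`topEigHeatCoercive_zero`), the `Z_q`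
  slope is controlled through the pointwise tangent inequality of `s ↦ s^{q/2}` by
  `GradientTensor.integral_rpow_mul_sum_strain_laplacian_le`, and the codomain nonlinear Poincaré
  inequality `CodomainNP.integral_norm_rpow_le_weighted` (exponent `q/2 − 1 > 0`, mean-zero field
  `strainFlat v`) gives `Z_q ≤ C_NP ∫‖S‖^{q−2}‖∇S‖²`; finally `αΦ_q + βZ_q ≤ Z_q`;
* §5 `TopEig.mix_saturatingLawSup`: (§2)+(§4) fed to the TREE
  `TopEig.hasDerivWithinAt_le_of_heatCoercive_admissible` give the law for the normalised mixture;
* §6 **`TopEig.topEigStrainMix_heatCoercive (hq : 2 < q) (hε : 0 ≤ ε) :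
  HeatCoercive (topEigStrainMix q ε) (ε * q / ((1 + ε) * npConst q))`** — the tree's own candidate
  `F_ε` is heat-coercive at a rate linear in `ε` (at `ε = 0` this is the heat sieve for `Φ_q`; a
  POSITIVE rate at `ε = 0` is exactly what the no-go seat's W18 family denies on the pen side — not
  asserted or refuted here).

`q = 2` is not covered (the exponent `q/2 − 1 > 0` is used twice). No rate exponent for `κ(ε)` is
claimed (pen remark only: the tree lemma's internal constant `κ(c) = qC^{1/(1−a)}(2β/q)^{−γ}`,
`β = c/(2+2c)`, would give `κ(ε) = O(ε^{−γ})`; it returns `∃ κ`). Nothing about Navier–Stokes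
regularity or blow-up: every statement is a field inequality or an implication between candidate a
priori inequalities along short-time classical solutions from smooth data.

Who checked what: census-2 (independent code B) typed and kernel-checked this file; STATUS: STAGED,
filing only on the lead's ruling (RIDER 2/b50). [ours; K1-Q6 (a), heat side]

Parts 1–2 (`TopEigMixDensity`, `TopEigStrainHeatLine`) carry §1–§2 and §3–§4a; this part 3 carries
§4b–§6 and imports part 2 under its proposed tree name. [part 3/3]
FILING (prove seat g25, REQUEST #17 part 3/3): census-2's `lean/mixlaw/v2/split/TopEigStrainMixHeat.lean` 318f77c746d53fa2, declarations byte-identical; one one-line docstring (`topEigStrainMix_heatCoercive_four`) and this line added for the gate's lints.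
-/
open MeasureTheory Set Filter Topology Finset
open scoped InnerProductSpace RealInnerProductSpace ContDiff

namespace Summit.NavierStokesRegularity.FunctionalMining

open Literature.Analysis.FunctionSpaces Literature.Analysis.FunctionSpaces.Torus
  Literature.Analysis.FluidPDE

namespace TopEig

open StrainL4 StrainMoment

/-- **The right derivative of the mixture along the heat line is `≤ −βq D_Z`.** For real `q > 2`,
`α, β ≥ 0`, and smooth divergence-free mean-zero `v` on `T³`:
`heatDissipation (αΦ_q + βZ_q) v ≥ β q D_Z(v)`. [ours] -/
theorem mix_heatDissipation_ge {q : ℝ} (hq : 2 < q) {α β : ℝ} (hα : 0 ≤ α) (hβ : 0 ≤ β)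
    {v : UnitAddTorus (Fin 3) → EuclideanSpace ℝ (Fin 3)} (hv : Torus.IsSmooth v)
    (hdiv : Torus.IsDivFree v) (hmean : Torus.HasZeroMean v) :
    β * q * strainGradDissipation q v ≤
      heatDissipation (fun w => α * torusTopEigMoment q w + β * torusStrainMoment q w) v := by
  have hq1 : (1 : ℝ) ≤ q := by linarith
  have hΔ : Torus.IsSmooth (Torus.laplacian v) := hv.laplacian
  -- convexity of the two line functions and of the mixture
  have hΦcvx : ConvexOn ℝ univ (fun t : ℝ => torusTopEigMoment q (v + t • Torus.laplacian v)) :=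
    convexOn_topEigMoment_line hq1 hv hΔ
  have hZcvx : ConvexOn ℝ univ (fun t : ℝ => torusStrainMoment q (v + t • Torus.laplacian v)) :=
    convexOn_strainMoment_line hq1 hv hΔ
  have hcvx : ConvexOn ℝ univ (fun t : ℝ =>
      (fun w => α * torusTopEigMoment q w + β * torusStrainMoment q w)
        (v + t • Torus.laplacian v)) := by
    have h := (ConvexOn.smul hα hΦcvx).add (ConvexOn.smul hβ hZcvx)
    refine h.congr fun t _ => ?_
    simp only [Pi.add_apply, smul_eq_mul]
  -- `heatDissipation` is minus the right derivative, for the mixture and for the `λ₁` part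
  obtain ⟨hder, heq⟩ := heatDissipation_eq_neg_rightDeriv (d := Fin 3)
    (Φ := fun w => α * torusTopEigMoment q w + β * torusStrainMoment q w) (v := v) hcvx
  obtain ⟨hderΦ, heqΦ⟩ := heatDissipation_topEigMoment_eq (d := Fin 3) hq1 hv
  rw [heq]
  set D := derivWithin (fun t : ℝ =>
      (fun w => α * torusTopEigMoment q w + β * torusStrainMoment q w)
        (v + t • Torus.laplacian v)) (Set.Ioi 0) 0 with hD
  set DΦ := derivWithin (fun t : ℝ => torusTopEigMoment q (v + t • Torus.laplacian v))
    (Set.Ioi 0) 0 with hDΦ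
  have hDΦ0 : DΦ ≤ 0 := by
    have h0 := topEigHeatCoercive_zero hq1 rfl v hv hdiv hmean
    rw [zero_mul, heqΦ] at h0
    linarith
  have ht := (hasDerivWithinAt_iff_tendsto_slope' self_notMem_Ioi).mp hder
  have htΦ := (hasDerivWithinAt_iff_tendsto_slope' self_notMem_Ioi).mp hderΦ
  -- the slope of the mixture, eventually, and its limit
  set ψ := strainLinePairing q v (Torus.laplacian v) with hψ
  have hψc : Continuous ψ := continuous_strainLinePairing hq hv hΔ
  have hev : ∀ᶠ τ in 𝓝[>] (0 : ℝ),
      slope (fun t : ℝ => (fun w => α * torusTopEigMoment q w + β * torusStrainMoment q w)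
        (v + t • Torus.laplacian v)) 0 τ ≤
      α * slope (fun t : ℝ => torusTopEigMoment q (v + t • Torus.laplacian v)) 0 τ + β * ψ τ := by
    filter_upwards [self_mem_nhdsWithin] with τ (hτ : 0 < τ)
    have hZ : torusStrainMoment q (v + τ • Torus.laplacian v) - torusStrainMoment q v ≤ τ * ψ τ :=
      strainMoment_line_sub_le hq hv hΔ τ
    rw [slope_def_field, slope_def_field, sub_zero]
    simp only [zero_smul, add_zero]
    rw [div_le_iff₀ hτ]
    calc α * torusTopEigMoment q (v + τ • Torus.laplacian v) +
          β * torusStrainMoment q (v + τ • Torus.laplacian v) -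
          (α * torusTopEigMoment q v + β * torusStrainMoment q v)
        = α * (torusTopEigMoment q (v + τ • Torus.laplacian v) - torusTopEigMoment q v) +
          β * (torusStrainMoment q (v + τ • Torus.laplacian v) - torusStrainMoment q v) := by ring
      _ ≤ α * (torusTopEigMoment q (v + τ • Torus.laplacian v) - torusTopEigMoment q v) +
          β * (τ * ψ τ) := add_le_add le_rfl (mul_le_mul_of_nonneg_left hZ hβ)
      _ = (α * ((torusTopEigMoment q (v + τ • Torus.laplacian v) - torusTopEigMoment q v) / τ) +
          β * ψ τ) * τ := by
          rw [add_mul, mul_assoc α, div_mul_cancel₀ _ hτ.ne']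
          ring
  have hlim : Tendsto (fun τ : ℝ =>
      α * slope (fun t : ℝ => torusTopEigMoment q (v + t • Torus.laplacian v)) 0 τ + β * ψ τ)
      (𝓝[>] (0 : ℝ)) (𝓝 (α * DΦ + β * ψ 0)) :=
    (htΦ.const_mul α).add (((hψc.tendsto 0).mono_left nhdsWithin_le_nhds).const_mul β)
  have hDle : D ≤ α * DΦ + β * ψ 0 := le_of_tendsto_of_tendsto ht hlim hev
  have hψ0 : ψ 0 ≤ -(q * strainGradDissipation q v) :=
    strainLinePairing_laplacian_zero_le hq hv
  have ha : α * DΦ ≤ 0 := mul_nonpos_of_nonneg_of_nonpos hα hDΦ0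
  have hb : β * ψ 0 ≤ β * (-(q * strainGradDissipation q v)) := mul_le_mul_of_nonneg_left hψ0 hβ
  linarith

/-- **Heat coercivity of the normalised mixture.** For real `q > 2` and `α, β ≥ 0` with
`α + β = 1`, the functional `α Φ_q + β Z_q` is heat-coercive on `T³` with rate `βq / C_NP(q)`:
`(βq/C_NP) (αΦ_q + βZ_q)(v) ≤ heatDissipation (αΦ_q + βZ_q) v` for smooth divergence-free mean-zero
`v`. [ours] -/
theorem mix_heatCoercive {q : ℝ} (hq : 2 < q) {α β : ℝ} (hα : 0 ≤ α) (hβ : 0 ≤ β)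
    (hαβ : α + β = 1) :
    HeatCoercive (d := Fin 3) (fun v => α * torusTopEigMoment q v + β * torusStrainMoment q v)
      (β * q / npConst q) := by
  intro _ v hv hdiv hmean
  have hq0 : (0 : ℝ) < q := by linarith
  have hC := npConst_pos hq
  have hdiss := mix_heatDissipation_ge hq hα hβ hv hdiv hmean
  have hNP := strainMoment_le_npConst_mul hq hv
  have hΦZ : torusTopEigMoment q v ≤ torusStrainMoment q v :=
    torusTopEigMoment_le_torusStrainMoment hq0 hv hdiv
  show β * q / npConst q * (α * torusTopEigMoment q v + β * torusStrainMoment q v) ≤ _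
  have h1 : α * torusTopEigMoment q v + β * torusStrainMoment q v ≤ torusStrainMoment q v := by
    have := mul_le_mul_of_nonneg_left hΦZ hα
    have e : α * torusStrainMoment q v + β * torusStrainMoment q v = torusStrainMoment q v := by
      rw [← add_mul, hαβ, one_mul]
    linarith
  have h2 : β * q / npConst q * (α * torusTopEigMoment q v + β * torusStrainMoment q v) ≤
      β * q / npConst q * torusStrainMoment q v :=
    mul_le_mul_of_nonneg_left h1 (div_nonneg (mul_nonneg hβ hq0.le) hC.le)
  have h3 : β * q / npConst q * torusStrainMoment q v ≤ β * q * strainGradDissipation q v := by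
    rw [div_mul_eq_mul_div, div_le_iff₀ hC]
    have := mul_le_mul_of_nonneg_left hNP (mul_nonneg hβ hq0.le)
    nlinarith
  linarith

/-! ## 5. The saturating law for the mixture -/

/-- **The normalised mixture obeys the saturating law**: for real `q > 2` and `α, β > 0` with
`α + β = 1` there is `κ ≥ 0` with `SaturatingLawSup (αΦ_q + βZ_q) (2q−3) ((3q−3)/(2q−3)) κ`.
[ours] -/
theorem mix_saturatingLawSup {q : ℝ} (hq : 2 < q) {α β : ℝ} (hα : 0 < α) (hβ : 0 < β)
    (hαβ : α + β = 1) :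
    ∃ κ : ℝ, 0 ≤ κ ∧ SaturatingLawSup (d := Fin 3)
      (fun v => α * torusTopEigMoment q v + β * torusStrainMoment q v)
      (2 * q - 3) ((3 * q - 3) / (2 * q - 3)) κ := by
  have hq0 : 0 < q := by linarith
  have hq1 : 1 ≤ q := by linarith
  set a := α ^ (1 / q) with hadef
  set b := β ^ (1 / q) with hbdef
  have ha : 0 ≤ a := Real.rpow_nonneg hα.le _
  have hb : 0 ≤ b := Real.rpow_nonneg hβ.le _
  have haq : a ^ q = α := by rw [hadef, one_div, Real.rpow_inv_rpow hα.le hq0.ne']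
  have hbq : b ^ q = β := by rw [hbdef, one_div, Real.rpow_inv_rpow hβ.le hq0.ne']
  have hab : a ^ q + b ^ q = 1 := by rw [haq, hbq, hαβ]
  have hc : 0 < β * q / npConst q := div_pos (mul_pos hβ hq0) (npConst_pos hq)
  obtain ⟨κ, hκ0, hκ⟩ := hasDerivWithinAt_le_of_heatCoercive_admissible hq.le
    (convexOn_mixDensity hq1 ha hb) (lipschitzWith_mixDensity hq1 ha hb hab)
    (fun w _ _ x => mixDensity_nonneg q ha hb _)
    (fun w hw hdw x => norm_le_six_mul_mixDensity hq0 ha hb hab (norm_strainFlat_le hw hdw x))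
    (fun w _ _ x => mixDensity_le_norm hq0 ha hb hab _)
    (Φ := fun w => α * torusTopEigMoment q w + β * torusStrainMoment q w)
    (fun w hw hdw => by
      show α * torusTopEigMoment q w + β * torusStrainMoment q w = _
      rw [integral_mixDensity_rpow hq0 ha hb hw hdw, haq, hbq])
    hc (mix_heatCoercive hq hα.le hβ.le hαβ)
  refine ⟨κ, hκ0, ?_⟩
  intro _ ν hν t₁ t₂ h12 u p hsol hmean t ht R hR
  calc R ≤ κ * ν ^ (-((3 * q - 3) / (2 * q - 3))) * ((2 * torusEnstrophy (u t)) *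
        (α * torusTopEigMoment q (u t) + β * torusStrainMoment q (u t)) ^ (1 + (2 * q - 3)⁻¹)) :=
        hκ hν h12 hsol hmean t ht R hR
    _ = κ * ν ^ (-((3 * q - 3) / (2 * q - 3))) * (2 * torusEnstrophy (u t)) *
        (α * torusTopEigMoment q (u t) + β * torusStrainMoment q (u t)) ^ (1 + (2 * q - 3)⁻¹) := by
        ring

/-! ## 6. The tree's candidate `F_ε` itself is heat-coercive at rate `εq/((1+ε)C_NP(q))` -/

/-- `heatDissipation (k·Φ) v = k · heatDissipation Φ v` for `k ≥ 0` (the supremum of the difference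
quotients scales; junk values included, `Real.mul_iSup_of_nonneg`). [ours, bookkeeping] -/
theorem heatDissipation_const_mul {d : Type*} [Fintype d] [DecidableEq d]
    (Φ : (UnitAddTorus d → EuclideanSpace ℝ d) → ℝ) {k : ℝ} (hk : 0 ≤ k)
    (v : UnitAddTorus d → EuclideanSpace ℝ d) :
    heatDissipation (fun w => k * Φ w) v = k * heatDissipation Φ v := by
  unfold heatDissipation
  rw [Real.mul_iSup_of_nonneg hk]
  refine iSup_congr fun t => ?_
  rw [← mul_sub, mul_div_assoc]

/-- **`F_ε = Φ_q + εZ_q` is heat-coercive at rate `εq/((1+ε)·npConst q)`** for real `q > 2` and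
`ε ≥ 0`: every smooth divergence-free zero-mean `v` on `T³` has
`(εq/((1+ε)C_NP)) · F_ε(v) ≤ heatDissipation F_ε v`. [ours; `mix_heatCoercive` rescaled by `1 + ε`] -/
theorem topEigStrainMix_heatCoercive {q ε : ℝ} (hq : 2 < q) (hε : 0 ≤ ε) :
    HeatCoercive (d := Fin 3) (topEigStrainMix q ε) (ε * q / ((1 + ε) * npConst q)) := by
  have h1ε : 0 < 1 + ε := by linarith
  set α : ℝ := (1 + ε)⁻¹ with hαdef
  set β : ℝ := ε * (1 + ε)⁻¹ with hβdef
  have hα : 0 ≤ α := (inv_pos.2 h1ε).le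
  have hβ : 0 ≤ β := mul_nonneg hε hα
  have hαβ : α + β = 1 := by
    rw [hαdef, hβdef]
    field_simp
  have hfun : topEigStrainMix (d := Fin 3) q ε =
      fun w => (1 + ε) * (α * torusTopEigMoment q w + β * torusStrainMoment q w) := by
    funext w
    unfold topEigStrainMix
    rw [hαdef, hβdef]
    field_simp
  intro hd v hv hdiv hmean
  have h := mix_heatCoercive hq hα hβ hαβ hd v hv hdiv hmean
  rw [hfun, heatDissipation_const_mul _ h1ε.le]
  have hC := npConst_pos hq
  have hrew : ε * q / ((1 + ε) * npConst q) *
      ((1 + ε) * (α * torusTopEigMoment q v + β * torusStrainMoment q v)) =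
      (1 + ε) * (β * q / npConst q * (α * torusTopEigMoment q v + β * torusStrainMoment q v)) := by
    rw [hβdef]
    field_simp
  rw [hrew]
  exact mul_le_mul_of_nonneg_left h h1ε.le

/-- The rows `q = 3`, `q = 4`: `F_ε` is heat-coercive at rates `3ε/((1+ε)·10206)` and
`4ε/((1+ε)·53136)`. [ours] -/
theorem topEigStrainMix_heatCoercive_three {ε : ℝ} (hε : 0 ≤ ε) :
    HeatCoercive (d := Fin 3) (topEigStrainMix 3 ε) (ε * 3 / ((1 + ε) * 10206)) := by
  have h := topEigStrainMix_heatCoercive (q := 3) (by norm_num) hε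
  have hnp : npConst 3 = 10206 := by
    unfold npConst
    rw [show (1 : ℝ) + ((3 : ℝ) / 2 - 1) = 3 / 2 by norm_num,
      show ((3 : ℝ) ^ ((3 : ℝ) / 2)) ^ 2 = 27 by
        rw [← Real.rpow_natCast, ← Real.rpow_mul (by norm_num)]; norm_num]
    norm_num
  rwa [hnp] at h

/-- The literal row `q = 4`: `HeatCoercive (topEigStrainMix 4 ε) (ε·4/((1+ε)·53136))` (`npConst 4 = 53136`). [ours; docstring added at filing] -/
theorem topEigStrainMix_heatCoercive_four {ε : ℝ} (hε : 0 ≤ ε) :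
    HeatCoercive (d := Fin 3) (topEigStrainMix 4 ε) (ε * 4 / ((1 + ε) * 53136)) := by
  have h := topEigStrainMix_heatCoercive (q := 4) (by norm_num) hε
  have hnp : npConst 4 = 53136 := by
    unfold npConst
    rw [show (1 : ℝ) + ((4 : ℝ) / 2 - 1) = 2 by norm_num,
      show ((3 : ℝ) ^ (2 : ℝ)) ^ 2 = 81 by
        rw [← Real.rpow_natCast, ← Real.rpow_mul (by norm_num)]; norm_num]
    norm_num
  rwa [hnp] at h

end TopEig

end Summit.NavierStokesRegularity.FunctionalMining
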